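import Summits.NavierStokesRegularity.FluidComputer.GateBudgetWindowFree
import HarnessLib

/-!
# What no tuning can beat, part 55: THE PULSE OF A MEMBER AT ANY TIME — from an entry clock
# `b(r) ≥ θ₁ε` (`θ₁ ≥ 5/4`), a lit trigger `c(r) ≥ ρ²/K¹⁰` and an entry radius `≤ 4ε²` at ANY
# `r ≥ 0`, the member douses by `T' ≤ r + 242/K⁹` with `c(T') ≤ λ₀ρ²`, `b(T') ≤ -(θ₁ - 10⁻⁵)ε`,
# the radius kept to `ε²/10⁶` and `ã(T') ≤ ã(r) + K(T' - r)`: the pulse half of a rung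

Cell `pub-fluidc`, blueprint seat bp1 (gen 34, fifth item, file 2 of 2); same namespace and
conventions as parts 1–54 (`GateBudget*.lean`); imports part 54 (`GateBudgetWindowFree`: the
horizon-free pulse window §162) and through it part 53 (§157 `radius_sqrt_lipschitz`, §158
`knob_radius_kept_free`), part 18 (`knob_output_growth`), part 11 (`knob_seed_le`) and
`headline_pow_floor`. The headline knob family `rotorCircuit K K¹⁰ ε ρ` (`M = K¹⁰`) from
(5.6), modes `0 = a`, `1 = b` clock, `2 = c` trigger, `4 = ã`; `R = b² + c²`; `λ₀ = 1/K¹⁰ +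
4e^{-K¹⁰}/K¹⁰` (part 43's dousing level). HONEST FRAMING (verbatim): low prior, high
value-of-information experiment on Tao's machine paradigm; NOT a claim that NS blows up.
Nothing is proved about the Navier–Stokes equations.

THE POINT (SPEC-INPUT-bp1 §AX, (20′b) law 2 of 5, the discharge). Part 52 §154 (the universal
pulse step) consumes, for a pulse `[r, T']` of a lattice member: `T' - r ≤ 242/K⁹`, `c > 0` on
`[r, T']`, `c(r) ≤ ρ²/K⁹`, `b(r) ≥ θ₁ε`, `b(T') ≤ -θ₂ε`, `c(T') ≤ λ₀ρ²`, a ring on `[r, T']`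
and `ã(T') ≤ ã(r) + K(T' - r)`. Parts 41/43/45/46 proved these for the SECOND pulse only, under
the horizon caps `s ≤ 4.4`, `T ≤ 5`. Here they follow for ANY ignition time `r ≥ 0` from three
local facts — entry clock `b(r) ≥ θ₁ε` (`θ₁ ≥ 5/4`), lit trigger `c(r) ≥ ρ²/K¹⁰`, entry
radius `b(r)² + c(r)² ≤ 4ε²` — by part 54 §162 run with `β = ε/4`, `γ = 13ε/20`, `ϱ = (θ₁ - 1/8)ε`,
`λ₁ = λ = 1/K¹⁰`, `H = 1/16` and the cap `c_M = 17ε/8`, where the ring `((θ₁ - 1/8)ε)²` and the cap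
on the horizon `[r, r + 1/16]` come from part 53 §157 (`|√R(t) - √R(r)| ≤ 2ε/16`, `θ₁ε ≤
√R(r) ≤ 2ε`, §164), the budget `Δ_A + Δ_B + Δ_C ≤ 242/K⁹` is §163, the kept radius is part 53
§158, and the exit clock is the kept radius read at `T'` (`b(T')² ≥ θ₁²ε² - 2·10⁻⁶ε²`, `b(T')
≤ -ε/4 < 0`).
* §163 `pulse_budget_free`: `K ≥ 16`, `0 < ε`, `0 < ρ`, `200ε/K²⁰ ≤ ρ²` ⇒ `Δ_A + Δ_B + Δ_C ≤
  242/K⁹` for the data above (`log(17εK¹⁰/(8ρ²)) ≤ 30 log K ≤ 30(K - 1)`, `Δ_B ≤ 2/K¹⁰`).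
* §164 three local lemmas: `dousing_level_small` (`λ₀ρ² ≤ ε/10³`), `exit_clock_of_kept_radius`
  (the exit clock from the kept radius, pure arithmetic), `knob_horizon_ring_cap` (cap `17ε/8`
  and ring `((θ₁ - 1/8)ε)²` on `[r, r + 1/16]` from part 53 §157 and the entry data).
* §165 `knob_pulse_free`: the member pulse law stated above (`∃ T'`, nine conjuncts incl. the
  dead clock `b ≤ -ε/4` on `[T', r + 1/16]` for the cold half).
HONEST LIMITS. (i) The ENTRY facts at `r` (clock re-armed to `θ₁ε`, trigger relit, radius) are
hypotheses: for the first ignition they are parts 18/37's, for the second part 47's (`θ₁ ≥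
1.265`), and for rung `n ≥ 3` they are the COLD half of (20′b) (laws 3–5, parts 39/47 re-typed
with part 53 §159), not in the tree; (ii) §164 gives `c(r) ≥ ρ²/K¹⁰` ⇒ pulse, while §154 also
wants `c(r) ≤ ρ²/K⁹` (the relight level) — an entry fact, not a conclusion; (iii) the budget
`242/K⁹` is kept for interface compatibility (parts 45/48/52/53); the true horizon-free pulse
length is `≈ 8(30 log K)/K¹⁰ ≈ 42/K⁹` at `K = 16`; (iv) `M = K¹⁰`, `K ≥ 16`, `200ε/K²⁰ ≤ ρ²`,
`K¹⁰ρ² ≤ 2ε` (no lattice, no `ε² ≤ 1/(6K²⁰)`); (v) nothing about Navier–Stokes.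
[cite: Tao2016AveragedNS, §5.5 Theorem 5.3, (5.5), (5.6), (b-eq), (c-eq), proof (ob-2), (est)]
-/

noncomputable section

namespace Summit.NavierStokesRegularity.FluidComputer.GateBudget

open Real Set Filter Topology
open Literature.Analysis.FluidPDE.Tao2016AveragedNS

/-! ## §163 The pulse budget, horizon-free -/

/-- **THE PULSE BUDGET, HORIZON-FREE.** `K ≥ 16`, `0 < ε`, `0 < ρ`, `200ε/K²⁰ ≤ ρ²`: with `β =
ε/4`, `γ = 13ε/20`, `λ₁ = λ = 1/K¹⁰`, `c_M = 17ε/8`, `M = K¹⁰` the three residences of part 54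
§162 total `≤ 242/K⁹` (`17εK¹⁰/(8ρ²) ≤ K³⁰`, `log K ≤ K - 1`: `Δ_A = Δ_C ≤ 120(K - 1)/K¹⁰`;
`Δ_B = 1/(2(169K¹⁰/400 - 1)) ≤ 2/K¹⁰`). [cite: Tao2016AveragedNS, §5.5 proof (ob-2)] -/
theorem pulse_budget_free {K ε ρ : ℝ} (hK : 16 ≤ K) (hε : 0 < ε) (hρ : 0 < ρ)
    (hlo : 200 * ε / K ^ 20 ≤ ρ ^ 2) :
    ε * log (17 * ε / 8 / (1 / K ^ 10 * ρ ^ 2)) / (K ^ 10 * (ε / 4))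
      + 2 * ε * (ε / 4) / (K ^ 10 * (13 * ε / 20) ^ 2 - ε ^ 2)
      + ε * log (17 * ε / 8 / (1 / K ^ 10 * ρ ^ 2)) / (K ^ 10 * (ε / 4)) ≤ 242 / K ^ 9 := by
  have hK0 : 0 < K := by linarith
  have hK10 : 0 < K ^ 10 := by positivity
  have h10 : (1099511627776 : ℝ) ≤ K ^ 10 := by
    have := headline_pow_floor hK 10; norm_num at this; exact this
  have hρ2 : 0 < ρ ^ 2 := by positivity
  have hε2 : 0 < ε ^ 2 := by positivity
  set Lg := log (17 * ε / 8 / (1 / K ^ 10 * ρ ^ 2)) with hLg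
  -- the logarithm: `17εK¹⁰/(8ρ²) ≤ K³⁰`, so `Lg ≤ 30 log K ≤ 30(K - 1)`
  have hlo' : 200 * ε ≤ ρ ^ 2 * K ^ 20 := (div_le_iff₀ (by positivity)).1 hlo
  have harg0 : 0 < 17 * ε / 8 / (1 / K ^ 10 * ρ ^ 2) := by positivity
  have harg : 17 * ε / 8 / (1 / K ^ 10 * ρ ^ 2) ≤ K ^ 30 := by
    rw [div_le_iff₀ (by positivity)]
    have e : K ^ 30 * (1 / K ^ 10 * ρ ^ 2) = ρ ^ 2 * K ^ 20 := by
      field_simp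
    rw [e]
    linarith
  have hLgb : Lg ≤ 30 * (K - 1) := by
    have h1 : Lg ≤ log (K ^ 30) := log_le_log harg0 harg
    rw [Real.log_pow] at h1
    have h2 : log K ≤ K - 1 := Real.log_le_sub_one_of_pos hK0
    push_cast at h1
    linarith [h1, h2]
  have hA : ε * Lg / (K ^ 10 * (ε / 4)) = 4 * Lg / K ^ 10 := by
    field_simp
  have hA' : 4 * Lg / K ^ 10 ≤ 120 * (K - 1) / K ^ 10 :=
    div_le_div_of_nonneg_right (by linarith) hK10.le
  -- the transit term
  have hεK : ε ^ 2 * 1099511627776 ≤ ε ^ 2 * K ^ 10 := mul_le_mul_of_nonneg_left h10 hε2.le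
  have hD : 0 < K ^ 10 * (13 * ε / 20) ^ 2 - ε ^ 2 := by nlinarith [hεK, hε2]
  have hB : 2 * ε * (ε / 4) / (K ^ 10 * (13 * ε / 20) ^ 2 - ε ^ 2) ≤ 2 / K ^ 10 := by
    rw [div_le_div_iff₀ hD hK10]
    nlinarith [hεK, hε2]
  rw [hA]
  have e9 : (242 : ℝ) / K ^ 9 = 242 * K / K ^ 10 := by
    field_simp
  calc 4 * Lg / K ^ 10 + 2 * ε * (ε / 4) / (K ^ 10 * (13 * ε / 20) ^ 2 - ε ^ 2) + 4 * Lg / K ^ 10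
      ≤ 120 * (K - 1) / K ^ 10 + 2 / K ^ 10 + 120 * (K - 1) / K ^ 10 := by linarith
    _ = (240 * (K - 1) + 2) / K ^ 10 := by ring
    _ ≤ 242 * K / K ^ 10 := div_le_div_of_nonneg_right (by linarith) hK10.le
    _ = 242 / K ^ 9 := e9.symm

/-! ## §164 Three local lemmas: the dousing level, the exit clock, the horizon ring and cap -/

/-- The dousing level is tiny: `K ≥ 16`, `K¹⁰ρ² ≤ 2ε` ⇒ `λ₀ρ² = (1/K¹⁰ + 4e^{-K¹⁰}/K¹⁰)ρ² ≤
ε/10³`. [cite: Tao2016AveragedNS, §5.5 proof (ob-2)] -/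
theorem dousing_level_small {K ε ρ : ℝ} (hK : 16 ≤ K) (hρ : 0 < ρ)
    (hhi : K ^ 10 * ρ ^ 2 ≤ 2 * ε) :
    (1 / K ^ 10 + 4 * exp (-K ^ 10) / K ^ 10) * ρ ^ 2 ≤ ε / 1000 := by
  have hK0 : 0 < K := by linarith
  have hK10 : 0 < K ^ 10 := by positivity
  have h10 : (1099511627776 : ℝ) ≤ K ^ 10 := by
    have := headline_pow_floor hK 10; norm_num at this; exact this
  have hρ2 : 0 < ρ ^ 2 := by positivity
  have hρK : ρ ^ 2 ≤ 2 * ε / K ^ 10 := by rw [le_div_iff₀ hK10]; linarith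
  have hex : exp (-K ^ 10) ≤ 1 := by rw [Real.exp_le_one_iff]; linarith
  have h5 : 1 / K ^ 10 + 4 * exp (-K ^ 10) / K ^ 10 ≤ 5 / K ^ 10 := by
    have h4 : 4 * exp (-K ^ 10) / K ^ 10 ≤ 4 / K ^ 10 :=
      div_le_div_of_nonneg_right (by linarith) hK10.le
    have e5 : (5 : ℝ) / K ^ 10 = 1 / K ^ 10 + 4 / K ^ 10 := by ring
    linarith
  have hiK : (5 : ℝ) / K ^ 10 ≤ 5 / 1099511627776 :=
    div_le_div_of_nonneg_left (by norm_num) (by norm_num) h10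
  have hε : 0 < ε := by nlinarith
  have h2K : 2 * ε / K ^ 10 ≤ 2 * ε / 1099511627776 :=
    div_le_div_of_nonneg_left (by positivity) (by norm_num) h10
  calc (1 / K ^ 10 + 4 * exp (-K ^ 10) / K ^ 10) * ρ ^ 2 ≤ 5 / 1099511627776 * ρ ^ 2 :=
        mul_le_mul_of_nonneg_right (h5.trans hiK) hρ2.le
    _ ≤ 5 / 1099511627776 * (2 * ε / 1099511627776) :=
        mul_le_mul_of_nonneg_left (hρK.trans h2K) (by norm_num)
    _ ≤ ε / 1000 := by linarith

/-- The exit clock from the kept radius: entry clock `b₀ ≥ θ₁ε` (`θ₁ ≥ 5/4`, `ε > 0`), radius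
dropped by at most `ε²/10⁶`, exit trigger `0 ≤ c ≤ ε/10³`, exit clock negative ⇒ `b ≤ -(θ₁ -
10⁻⁵)ε`. [cite: Tao2016AveragedNS, §5.5 proof (ob-2)] -/
theorem exit_clock_of_kept_radius {ε θ₁ b c b₀ c₀ : ℝ} (hε : 0 < ε) (hθ₁ : 5 / 4 ≤ θ₁)
    (hb₀ : θ₁ * ε ≤ b₀) (hR : -(ε ^ 2 / 10 ^ 6) ≤ b ^ 2 + c ^ 2 - (b₀ ^ 2 + c₀ ^ 2))
    (hc0 : 0 ≤ c) (hc : c ≤ ε / 1000) (hb : b < 0) : b ≤ -((θ₁ - 1 / 10 ^ 5) * ε) := by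
  have hε2 : 0 < ε ^ 2 := by positivity
  have hθε : 0 ≤ θ₁ * ε := by nlinarith
  have hc2 : c ^ 2 ≤ (ε / 1000) ^ 2 := pow_le_pow_left₀ hc0 hc 2
  have hb2 : (θ₁ * ε) ^ 2 ≤ b₀ ^ 2 := pow_le_pow_left₀ hθε hb₀ 2
  have hθε2 : 5 / 4 * ε ^ 2 ≤ θ₁ * ε ^ 2 := mul_le_mul_of_nonneg_right hθ₁ hε2.le
  have hy2 : ((θ₁ - 1 / 10 ^ 5) * ε) ^ 2 ≤ b ^ 2 := by
    nlinarith [hR, hc2, hb2, sq_nonneg c₀, hθε2]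
  by_contra hcon
  have hlt := not_le.1 hcon
  have hy0 : 0 < (θ₁ - 1 / 10 ^ 5) * ε - b := by nlinarith
  nlinarith [mul_pos (by linarith : 0 < b + (θ₁ - 1 / 10 ^ 5) * ε) hy0]

variable {K M ε ρ : ℝ} {X : ℝ → Fin 5 → ℝ}

/-- The horizon ring and cap from the entry radius (knob family, `M ≥ 0`, `0 < ε`, `ρ² ≤ ε`): at
`r ≥ 0` with `b(r) ≥ θ₁ε` and `b(r)² + c(r)² ≤ 4ε²`, part 53 §157 gives `c ≤ 17ε/8` and `b² +
c² ≥ ((θ₁ - 1/8)ε)²` on `[r, r + 1/16]`. [cite: Tao2016AveragedNS, §5.5 (5.5), (5.6)] -/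
theorem knob_horizon_ring_cap (hX : ∀ t, HasDerivAt X (RotorKnob.rotorCircuit K M ε ρ (X t)) t)
    (h0 : X 0 = delayInit) (hM : 0 ≤ M) (hε : 0 < ε) (hρε : ρ ^ 2 ≤ ε) {r θ₁ : ℝ} (hr : 0 ≤ r)
    (hθ₁ : 1 / 8 ≤ θ₁) (hbr : θ₁ * ε ≤ X r 1) (hRr : X r 1 ^ 2 + X r 2 ^ 2 ≤ 4 * ε ^ 2) :
    ∀ t ∈ Icc r (r + 1 / 16),
      X t 2 ≤ 17 * ε / 8 ∧ ((θ₁ - 1 / 8) * ε) ^ 2 ≤ X t 1 ^ 2 + X t 2 ^ 2 := by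
  have hXf := hX
  rw [RotorKnob.rotorCircuit_eq_fiveGate] at hXf
  obtain ⟨hσ0, hσε⟩ := knob_seed_le hε hρε hM
  have hRr0 : 0 ≤ X r 1 ^ 2 + X r 2 ^ 2 := by positivity
  have hvε : √(X r 1 ^ 2 + X r 2 ^ 2) ≤ 2 * ε := by
    rw [show 2 * ε = √((2 * ε) ^ 2) from (Real.sqrt_sq (by positivity)).symm]
    exact Real.sqrt_le_sqrt (by nlinarith [hRr])
  have hb0 : 0 ≤ X r 1 := le_trans (by nlinarith) hbr
  have hvθ : θ₁ * ε ≤ √(X r 1 ^ 2 + X r 2 ^ 2) := by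
    calc θ₁ * ε ≤ X r 1 := hbr
      _ = √(X r 1 ^ 2) := (Real.sqrt_sq hb0).symm
      _ ≤ √(X r 1 ^ 2 + X r 2 ^ 2) := Real.sqrt_le_sqrt (by nlinarith [sq_nonneg (X r 2)])
  intro t ht
  obtain ⟨h1, h2⟩ := radius_sqrt_lipschitz hXf h0 hε.le hσ0 hr ht
  have hτ : (ε + ρ ^ 2 * exp (-M)) * (t - r) ≤ 2 * ε * (1 / 16) :=
    mul_le_mul (by linarith) (by linarith [ht.2]) (by linarith [ht.1]) (by positivity)
  have hc0 : 0 ≤ X t 2 := RotorKnob.c_nonneg hX h0 (hr.trans ht.1)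
  have hcs : X t 2 ≤ √(X t 1 ^ 2 + X t 2 ^ 2) := by
    calc X t 2 = √(X t 2 ^ 2) := (Real.sqrt_sq hc0).symm
      _ ≤ √(X t 1 ^ 2 + X t 2 ^ 2) := Real.sqrt_le_sqrt (by nlinarith [sq_nonneg (X t 1)])
  have hRt0 : 0 ≤ X t 1 ^ 2 + X t 2 ^ 2 := by positivity
  have hu2 : √(X t 1 ^ 2 + X t 2 ^ 2) ^ 2 = X t 1 ^ 2 + X t 2 ^ 2 := Real.sq_sqrt hRt0
  refine ⟨by linarith, ?_⟩
  have hy : 0 ≤ (θ₁ - 1 / 8) * ε := mul_nonneg (by linarith) hε.le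
  have hlow : (θ₁ - 1 / 8) * ε ≤ √(X t 1 ^ 2 + X t 2 ^ 2) := by nlinarith
  rw [← hu2]
  exact pow_le_pow_left₀ hy hlow 2

variable {K ε ρ : ℝ} {X : ℝ → Fin 5 → ℝ}

/-! ## §165 The pulse of a member at any time -/

/-- **THE PULSE OF A MEMBER AT ANY TIME.** Headline family `rotorCircuit K K¹⁰ ε ρ`, `K ≥ 16`,
`0 < ε`, `0 < ρ`, `200ε/K²⁰ ≤ ρ²`, `K¹⁰ρ² ≤ 2ε`, the trajectory from (5.6); ANY time `r ≥ 0`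
with entry clock `b(r) ≥ θ₁ε` (`θ₁ ≥ 5/4`), lit trigger `c(r) ≥ ρ²/K¹⁰` and entry radius `b(r)²
+ c(r)² ≤ 4ε²`. Then there is a dousing time `T'` with `r < T'`, `T' - r ≤ 242/K⁹`, `T' < r +
1/16`, `c > 0` on `[r, T']`, `c(T') ≤ (1/K¹⁰ + 4e^{-K¹⁰}/K¹⁰)ρ²`, `b(T') ≤ -(θ₁ - 10⁻⁵)ε`, `b ≤
-ε/4` on `[T', r + 1/16]`, `|b² + c² - (b(r)² + c(r)²)| ≤ ε²/10⁶` on `[r, T']`, `ã(T') ≤ ã(r)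
+ K(T' - r)` — part 54 §162 at `β = ε/4`, `γ = 13ε/20`, `ϱ = (θ₁ - 1/8)ε ≥ 9ε/8`, `λ₁ = λ =
1/K¹⁰`, `H = 1/16`, `c_M = 17ε/8` (ring and cap by §164 from part 53 §157), the budget §163,
part 53 §158, and the exit clock by §164 (`c(T') ≤ λ₀ρ² ≤ ε/10³`, `b(T') ≤ -ε/4 < 0`).
[cite: Tao2016AveragedNS, §5.5 Theorem 5.3, (5.5), (5.6), (b-eq), (c-eq), proof (ob-2)] -/
theorem knob_pulse_free
    (hX : ∀ t, HasDerivAt X (RotorKnob.rotorCircuit K (K ^ 10) ε ρ (X t)) t)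
    (h0 : X 0 = delayInit) (hK : 16 ≤ K) (hε : 0 < ε) (hρ : 0 < ρ)
    (hlo : 200 * ε / K ^ 20 ≤ ρ ^ 2) (hhi : K ^ 10 * ρ ^ 2 ≤ 2 * ε)
    {r θ₁ : ℝ} (hr : 0 ≤ r) (hθ₁ : 5 / 4 ≤ θ₁) (hbr : θ₁ * ε ≤ X r 1)
    (hcr : ρ ^ 2 / K ^ 10 ≤ X r 2) (hRr : X r 1 ^ 2 + X r 2 ^ 2 ≤ 4 * ε ^ 2) :
    ∃ T' : ℝ, r < T' ∧ T' - r ≤ 242 / K ^ 9 ∧ T' < r + 1 / 16 ∧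
      (∀ t ∈ Icc r T', 0 < X t 2) ∧
      X T' 2 ≤ (1 / K ^ 10 + 4 * exp (-K ^ 10) / K ^ 10) * ρ ^ 2 ∧
      X T' 1 ≤ -((θ₁ - 1 / 10 ^ 5) * ε) ∧
      (∀ t ∈ Icc T' (r + 1 / 16), X t 1 ≤ -(ε / 4)) ∧
      (∀ t ∈ Icc r T', |X t 1 ^ 2 + X t 2 ^ 2 - (X r 1 ^ 2 + X r 2 ^ 2)| ≤ ε ^ 2 / 10 ^ 6) ∧
      X T' 4 ≤ X r 4 + K * (T' - r) := by
  have hK0 : 0 < K := by linarith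
  have hK10 : 0 < K ^ 10 := by positivity
  have h10 : (1099511627776 : ℝ) ≤ K ^ 10 := by
    have := headline_pow_floor hK 10; norm_num at this; exact this
  have h9 : (68719476736 : ℝ) ≤ K ^ 9 := by
    have := headline_pow_floor hK 9; norm_num at this; exact this
  have hK9 : 0 < K ^ 9 := by positivity
  have hρ2 : 0 < ρ ^ 2 := by positivity
  have hρε : ρ ^ 2 ≤ ε := by nlinarith [mul_le_mul_of_nonneg_right h10 hρ2.le]
  have hε2 : 0 < ε ^ 2 := by positivity
  have hεK : ε ^ 2 * 1099511627776 ≤ ε ^ 2 * K ^ 10 := mul_le_mul_of_nonneg_left h10 hε2.le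
  have hθε : 5 / 4 * ε ≤ θ₁ * ε := mul_le_mul_of_nonneg_right hθ₁ hε.le
  -- §164: the cap `17ε/8` and the ring `((θ₁ - 1/8)ε)²` on the horizon `[r, r + 1/16]`
  have hrc := knob_horizon_ring_cap hX h0 hK10.le hε hρε hr (by linarith) hbr hRr
  -- the budget (§163) and the window (part 54 §162)
  have hbud := pulse_budget_free hK hε hρ hlo
  have h242 : (242 : ℝ) / K ^ 9 < 1 / 16 := by
    rw [div_lt_div_iff₀ hK9 (by norm_num)]
    linarith
  have hu₁ : 1 / K ^ 10 * ρ ^ 2 ≤ X r 2 := by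
    rw [show 1 / K ^ 10 * ρ ^ 2 = ρ ^ 2 / K ^ 10 by ring]; exact hcr
  have hγϱ : (13 * ε / 20) ^ 2 + (ε / 4) ^ 2 ≤ ((θ₁ - 1 / 8) * ε) ^ 2 := by
    have h98 : 9 / 8 * ε ≤ (θ₁ - 1 / 8) * ε := by linarith
    have := pow_le_pow_left₀ (by positivity) h98 2
    nlinarith [hε2]
  obtain ⟨t₁, t₂, T', h01, h12, h2T, hTΔ, hTH, -, -, -, -, hdead, hcT, -, hcpos⟩ :=
    knob_pulse_window_free hX h0 hε hρ hρε hK10 (s₀ := r) (H := 1 / 16) (β := ε / 4)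
      (ϱ := (θ₁ - 1 / 8) * ε) (γ := 13 * ε / 20) (lam₁ := 1 / K ^ 10) (lam := 1 / K ^ 10)
      (cM := 17 * ε / 8) hr (by norm_num) (by positivity) (by linarith) (by positivity) hγϱ
      (by nlinarith [hεK, hε2]) (fun t ht => (hrc t ht).2) (fun t ht => (hrc t ht).1) hu₁
      (by positivity) le_rfl (by linarith)
  have hτ : T' - r ≤ 242 / K ^ 9 := hTΔ.trans hbud
  -- the kept radius (part 53 §158), the dousing level and the exit clock (§164)
  have hkept := knob_radius_kept_free hX h0 hK10.le hε hρε hK hr hτ hRr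
  have hcT' : X T' 2 ≤ (1 / K ^ 10 + 4 * exp (-K ^ 10) / K ^ 10) * ρ ^ 2 := by
    have e : ε * exp (-K ^ 10) / (K ^ 10 * (ε / 4)) = 4 * exp (-K ^ 10) / K ^ 10 := by
      rw [div_eq_div_iff (by positivity) (by positivity)]
      ring
    rw [e] at hcT
    exact hcT
  have hbT : X T' 1 ≤ -((θ₁ - 1 / 10 ^ 5) * ε) :=
    exit_clock_of_kept_radius hε hθ₁ hbr (abs_le.1 (hkept T' ⟨by linarith, le_rfl⟩)).1
      (RotorKnob.c_nonneg hX h0 (by linarith)) (hcT'.trans (dousing_level_small hK hρ hhi))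
      (by linarith [hdead T' ⟨h2T, hTH.le⟩])
  exact ⟨T', by linarith, hτ, hTH, fun t ht => hcpos t ⟨ht.1, by linarith [ht.2]⟩, hcT', hbT,
    fun t ht => hdead t ⟨by linarith [ht.1], ht.2⟩, hkept,
    knob_output_growth hX h0 hK0.le (by linarith)⟩

end Summit.NavierStokesRegularity.FluidComputer.GateBudget
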